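import Literature.Computability.Cryptography.ChenQuantumLWELineTranslation

/-!
# Digit observers of the Step-9 register, II: the box-wrap bound (Lemma C in the kernel, T21)

REPRODUCTION / ANALYSIS OF A CLAIMED RESULT UNDER ADJUDICATION (withdrawn): Yilei Chen, *Quantum
Algorithms for Lattice Problems*, IACR ePrint 2024/555, version of 2024-04-18 [ChenQuantumLattice2024]
(the version carrying the author's note that Step 9 contains a bug), Step 9 (§3.5.9, pp. 34–38) acting
on the line ket `|φ8.b⟩ = Σ_{j ∈ ℤ_P} ψ_P(−j²) |2D²j·b + v′ mod N⟩` (p. 35), with the secret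
`b = [−1, 2p₁sᵀ, 2p₁eᵀ]ᵀ` of eq. (12) (p. 17), the LWE instance as the `q`-ary lattice
`L_q^⊥` of §3.2 (pp. 16–18) and the Step-8 value of Claim 3.14 (pp. 33–34).  Bundle
`papers/QuantumAdvantage/lwe-quantum-autopsy/`, Part 2 (`REPAIR-CENSUS.md` §26.2 "Lemma C" and §30,
theorem **T21**, census row G7), sequel of `ChenQuantumLWELineTranslation.lean` (T17:
`digitObserver_le`, `residueShift`, `lawShiftDefect`, `guessSuccess`), whose by-hand complement it
moves into the kernel.  HONEST FRAMING: kernel-checked THEOREMS about the measurement statistics of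
states occurring in a WITHDRAWN algorithm — an elementary counting bound that makes the disposal of the
instance-aware "digit observers" (census row G7, items (B2)/(B3)) QUANTITATIVE with pinned constants;
NOT summit progress, no cryptanalytic claim in either direction, no new algorithm.

## What is proved

**A. Push-forward laws** (pure counting).  A hidden vector `a` uniform on a finite set `R ⊆ A` (weights
`c = 1/#R`) seen only through `π : A → V` (`V` finite) has the law `pushLaw R π c`
(`v ↦ c · #{a ∈ R : π a = v}`, mass `c · #R`, `sum_pushLaw`); the success of any observer whose kernel
and target factor through `π` is the success of the push-forward law
(`mul_sum_success_eq_guessSuccess_pushLaw`); and — the point — if an injective `τ : A → A` lies over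
a bijection `σ` of `V` (`π ∘ τ = σ ∘ π` on `R`), then the DEFECT of the push-forward law under `σ`
(T17's `lawShiftDefect`) is at most `c · #{a ∈ R : τ a ∉ R}`, the probability that `τ` moves a
uniform point of `R` OUT of `R` (`lawShiftDefect_pushLaw_le`; census §26.2 (ii)).

**B. The box** (pure counting).  `intBox m q = [0,q)^m ⊂ ℤ^m`.  In dimension one at most `|c|` residues
leave `[0,q)` under `x ↦ x + c` (`card_Ico_filter_add_not_mem_le`); hence for `R ⊆ [0,q)^m` with
UNIFORM COORDINATE MARGINALS (`q · #{a ∈ R : a_i = x} = #R` for all `i`, `x`) the union bound gives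
`q · #{a ∈ R : a + s ∉ [0,q)^m} ≤ #R · ‖s‖₁` (`mul_card_filter_add_not_mem_intBox_le`), and with the
CLOSURE property (`a ∈ R`, `a + s ∈ box ⇒ a + s ∈ R`: e.g. `R` = lattice ∩ box, `s` a lattice
vector) the probability that the translate by `s` leaves `R` is at most `‖s‖₁ / q`
(`exitProb_le`; census §26.2 (iii)).

**C. The register** (`finsetDigitObserver_le`, `boxDigitObserver_le`, `chenBoxDigitObserver_le`,
`chenBoxDigitObserver_le_centred`).  Odd `P = p₁Q`, `b₀ = −1`, `2D²p₁` a unit mod `Q` (Chen's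
admissible shapes).  A hidden vector `a` uniform on a finite `R ⊂ ℤ^m` carries the offset
`off a ∈ ℤ^{n+1}` of the Step-9 register `|φ_{b, off a}⟩` and side information `f a` (anything:
the instance, the secret, `k′`, the Step-8 value); translations `a ↦ a + s_k` (`k ∈ ℤ_Q`) act on the
offset as the line translations by `p₁t_k` steps (mod `N`) and fix `f` on `R`.  Then EVERY digit
observer (computational-basis measurement of all coordinates, any randomised post-processing `g` of
the outcome and of `f a`) reads the datum `(off a)₀ mod Q` with probability at most
`(1 + Σ_k Pr_a[a + s_k ∉ R]) / Q` (A + T17); at most `1/Q + (Σ_k ‖s_k‖₁)/(Q·q)` when `R ⊆ [0,q)^m`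
has the closure property and uniform marginals (B); for Chen's offsets `v′ = D·(w₀ − ν)` and
translations `ν ↦ ν − 2Dp₁t_k·b` this is `1/Q + 2Dp₁‖b‖₁(Σ_k |t_k|)/(Q·q)`, and for the CENTRED
residue system (`t_k = valMinAbs k`, `Σ_k |t_k| = (Q² − 1)/4`, `sum_natAbs_valMinAbs`) it is
**`1/Q + Dp₁(Q² − 1)‖b‖₁ / (2Qq)`** — census §26.2's `1/C + W`, `W ≤ Dp₁(C²−1)‖b‖₁/(2Cq)`, now with
every constant pinned by the kernel (dictionary: this module's `Q` is the census's `C`).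

**D. Parity-check boxes** (`checkBox`, `checkBox_closed`, `chenCheckBoxDigitObserver_le_centred`).
`R = L_q^⊥(A) ∩ [0,q)^m` — the points of the box annihilated by additive checks `κ_j` into `ℤ_q` — is
non-empty and has the CLOSURE property under every vector annihilated by the checks (so under every
integer multiple of Chen's `b ∈ L_q^⊥(A)`); hence on it the bound of C holds with the uniform-marginals
hypothesis as the ONLY remaining input.

## What is NOT here

The identification of Chen's hidden-vector law with the uniform law on `R = L_q^⊥(A) ∩ [0,q)^n`
(census §24.3, Lemma A) and the uniform-marginals hypothesis for it (every public row of the instance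
non-zero mod `q`: all instances but a `q^{−ℓ}` fraction per row — census §26.2 (iii), by hand);
coherent (non-diagonal) instance-aware measurements (census row G7's residual, G7a); any cryptanalytic
claim.
-/

namespace Literature.Computability.Cryptography.Chen2024

open scoped BigOperators

/-! ### A. Push-forward laws: fibre counts, success, defect -/

section PushForward

variable {A V : Type*} [Fintype V] [DecidableEq V]

/-- The number of points of the finite set `R` in the fibre of `π` over `v`. [folklore] -/
def fibreCard (R : Finset A) (π : A → V) (v : V) : ℕ := (R.filter fun a => π a = v).card

/-- The fibres partition `R`: `Σ_v #{a ∈ R : π a = v} = #R`. [folklore] -/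
theorem sum_fibreCard (R : Finset A) (π : A → V) : ∑ v, fibreCard R π v = R.card := by
  have H : (↑R : Set A).MapsTo π ↑(Finset.univ : Finset V) :=
    fun a _ => Finset.mem_coe.2 (Finset.mem_univ _)
  unfold fibreCard
  rw [Finset.card_eq_sum_card_fiberwise H]

/-- The push-forward along `π : A → V` of `c ·`(counting measure of `R`): `v ↦ c · #{a ∈ R : π a = v}`;
for `c = 1/#R` this is the law of `π a` for `a` uniform on `R`. [folklore] -/
def pushLaw (R : Finset A) (π : A → V) (c : ℝ) (v : V) : ℝ := c * (fibreCard R π v : ℝ)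

/-- Total mass of the push-forward: `c · #R` (`= 1` for `c = 1/#R`, `R ≠ ∅`). [folklore] -/
theorem sum_pushLaw (R : Finset A) (π : A → V) (c : ℝ) :
    ∑ v, pushLaw R π c v = c * (R.card : ℝ) := by
  unfold pushLaw
  rw [← Finset.mul_sum, ← Nat.cast_sum, sum_fibreCard]

/-- The push-forward of the uniform law on a non-empty `R` has mass `1`. [folklore] -/
theorem sum_pushLaw_uniform (R : Finset A) (hR : R.Nonempty) (π : A → V) :
    ∑ v, pushLaw R π (R.card : ℝ)⁻¹ v = 1 := by
  rw [sum_pushLaw]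
  exact inv_mul_cancel₀ (Nat.cast_ne_zero.2 hR.card_pos.ne')

/-- The success of an observer of a hidden `a ∈ R` (weights `c` on `R`) whose observation kernel and
target FACTOR THROUGH `π` equals T17's `guessSuccess` of the push-forward law. [folklore] -/
theorem mul_sum_success_eq_guessSuccess_pushLaw {O T : Type*} [Fintype O] (R : Finset A)
    (π : A → V) (c : ℝ) (m : A → O → ℝ) (m' : V → O → ℝ) (hm : ∀ a ∈ R, ∀ o, m a o = m' (π a) o)
    (g : O → T → ℝ) (tgt : A → T) (tgt' : V → T) (htgt : ∀ a ∈ R, tgt a = tgt' (π a)) :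
    c * ∑ a ∈ R, ∑ o, m a o * g o (tgt a) = guessSuccess (pushLaw R π c) m' g tgt' := by
  unfold guessSuccess pushLaw fibreCard
  have H : (↑R : Set A).MapsTo π ↑(Finset.univ : Finset V) :=
    fun a _ => Finset.mem_coe.2 (Finset.mem_univ _)
  rw [← Finset.sum_fiberwise_of_maps_to H, Finset.mul_sum]
  refine Finset.sum_congr rfl fun v _ => ?_
  have hin : ∀ a ∈ R.filter (fun a => π a = v),
      ∑ o, m a o * g o (tgt a) = ∑ o, m' v o * g o (tgt' v) := by
    intro a ha
    obtain ⟨haR, hav⟩ := Finset.mem_filter.1 ha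
    simp only [hm a haR, htgt a haR, hav]
  rw [Finset.sum_congr rfl hin, Finset.sum_const, nsmul_eq_mul, mul_assoc]

/-- **The defect of a push-forward is at most the exit probability upstairs** (census §26.2 (ii)).
If `τ : A → A`, injective on `R`, lies over a bijection `σ` of `V` (`π (τ a) = σ (π a)` for `a ∈ R`),
then `defect(pushLaw, σ) ≤ c · #{a ∈ R : τ a ∉ R}` — for `c = 1/#R` the probability that `τ` moves a
uniform point of `R` out of `R`.  (Proof: over `σ v` the push-forward counts at least the `τ`-images
of the points over `v` that stay in `R`; summing the excess over `v` counts each point of `R` that is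
not hit from inside at most once.) [folklore] -/
theorem lawShiftDefect_pushLaw_le [DecidableEq A] (R : Finset A) (π : A → V) {c : ℝ} (hc : 0 ≤ c)
    (τ : A → A) (hτ : Set.InjOn τ ↑R) (σ : V → V) (hσ : Function.Bijective σ)
    (hcomm : ∀ a ∈ R, π (τ a) = σ (π a)) :
    lawShiftDefect (pushLaw R π c) σ ≤ c * ((R.filter fun a => τ a ∉ R).card : ℝ) := by
  -- `R'` = the points that stay; `z v` = those of them landing over `σ v`
  have hz_le : ∀ v, fibreCard (R.filter fun a => τ a ∈ R) (fun a => π (τ a)) (σ v)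
      ≤ fibreCard R π v := by
    intro v
    refine Finset.card_le_card fun a ha => ?_
    simp only [Finset.mem_filter] at ha ⊢
    refine ⟨ha.1.1, hσ.1 ?_⟩
    rw [← hcomm a ha.1.1]
    exact ha.2
  have hz_le' : ∀ v, fibreCard (R.filter fun a => τ a ∈ R) (fun a => π (τ a)) (σ v)
      ≤ fibreCard R π (σ v) := by
    intro v
    refine Finset.card_le_card_of_injOn τ (fun a ha => ?_) (fun a ha a' ha' h => ?_)
    · simp only [Finset.coe_filter, Set.mem_setOf_eq, Finset.mem_filter] at ha ⊢
      exact ⟨ha.1.2, ha.2⟩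
    · simp only [Finset.coe_filter, Set.mem_setOf_eq, Finset.mem_filter] at ha ha'
      exact hτ (Finset.mem_coe.2 ha.1.1) (Finset.mem_coe.2 ha'.1.1) h
  have hpt : ∀ v, max (pushLaw R π c (σ v) - pushLaw R π c v) 0
      ≤ c * (fibreCard R π (σ v) : ℝ)
        - c * (fibreCard (R.filter fun a => τ a ∈ R) (fun a => π (τ a)) (σ v) : ℝ) := by
    intro v
    have h1 : (fibreCard (R.filter fun a => τ a ∈ R) (fun a => π (τ a)) (σ v) : ℝ)
        ≤ fibreCard R π v := by exact_mod_cast hz_le v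
    have h2 : (fibreCard (R.filter fun a => τ a ∈ R) (fun a => π (τ a)) (σ v) : ℝ)
        ≤ fibreCard R π (σ v) := by exact_mod_cast hz_le' v
    unfold pushLaw
    refine max_le ?_ ?_
    · linarith [mul_le_mul_of_nonneg_left h1 hc]
    · linarith [mul_le_mul_of_nonneg_left h2 hc]
  have hsum1 : ∑ v, (fibreCard R π (σ v) : ℝ) = R.card := by
    rw [hσ.sum_comp (fun v => (fibreCard R π v : ℝ)), ← Nat.cast_sum, sum_fibreCard]
  have hsum2 : ∑ v, (fibreCard (R.filter fun a => τ a ∈ R) (fun a => π (τ a)) (σ v) : ℝ)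
      = (R.filter fun a => τ a ∈ R).card := by
    rw [hσ.sum_comp (fun w => (fibreCard (R.filter fun a => τ a ∈ R) (fun a => π (τ a)) w : ℝ)),
      ← Nat.cast_sum, sum_fibreCard]
  have hsplit : ((R.filter fun a => τ a ∈ R).card : ℝ) + ((R.filter fun a => τ a ∉ R).card : ℝ)
      = R.card := by
    exact_mod_cast Finset.card_filter_add_card_filter_not (s := R) (fun a => τ a ∈ R)
  calc lawShiftDefect (pushLaw R π c) σ
      = ∑ v, max (pushLaw R π c (σ v) - pushLaw R π c v) 0 := rfl
    _ ≤ ∑ v, (c * (fibreCard R π (σ v) : ℝ)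
          - c * (fibreCard (R.filter fun a => τ a ∈ R) (fun a => π (τ a)) (σ v) : ℝ)) :=
        Finset.sum_le_sum fun v _ => hpt v
    _ = c * ∑ v, (fibreCard R π (σ v) : ℝ)
          - c * ∑ v, (fibreCard (R.filter fun a => τ a ∈ R) (fun a => π (τ a)) (σ v) : ℝ) := by
        rw [Finset.sum_sub_distrib, Finset.mul_sum, Finset.mul_sum]
    _ = c * ((R.filter fun a => τ a ∉ R).card : ℝ) := by
        rw [hsum1, hsum2, ← hsplit]
        ring

end PushForward

/-! ### B. The box `[0,q)^m`: exit counts under translation -/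

section Box

variable {m : ℕ}

/-- The box `[0,q)^m ⊂ ℤ^m` of canonical representatives mod `q`. [folklore] -/
noncomputable def intBox (m q : ℕ) : Finset (Fin m → ℤ) := Fintype.piFinset fun _ => Finset.Ico (0 : ℤ) q

/-- Membership in the box is coordinatewise. [folklore] -/
theorem mem_intBox {q : ℕ} {a : Fin m → ℤ} : a ∈ intBox m q ↔ ∀ i, a i ∈ Finset.Ico (0 : ℤ) q := by
  unfold intBox
  exact Fintype.mem_piFinset

/-- In dimension one at most `|c|` residues leave `[0,q)` under `x ↦ x + c` (exactly `min(|c|, q)`).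
[folklore] -/
theorem card_Ico_filter_add_not_mem_le (q : ℕ) (c : ℤ) :
    ((Finset.Ico (0 : ℤ) q).filter fun x => x + c ∉ Finset.Ico (0 : ℤ) q).card ≤ c.natAbs := by
  calc ((Finset.Ico (0 : ℤ) q).filter fun x => x + c ∉ Finset.Ico (0 : ℤ) q).card
      ≤ (Finset.Ico ((q : ℤ) - c) q ∪ Finset.Ico 0 (-c)).card := by
        refine Finset.card_le_card fun x hx => ?_
        simp only [Finset.mem_filter, Finset.mem_Ico, not_and, not_lt] at hx
        simp only [Finset.mem_union, Finset.mem_Ico]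
        omega
    _ ≤ (Finset.Ico ((q : ℤ) - c) q).card + (Finset.Ico 0 (-c)).card := Finset.card_union_le _ _
    _ = c.natAbs := by
        rw [Int.card_Ico, Int.card_Ico, ← Int.toNat_add_toNat_neg_eq_natAbs]
        congr 1 <;> congr 1 <;> ring

/-- **Union bound with uniform marginals** (census §26.2 (iii)).  If `R ⊆ [0,q)^m` and every
coordinate of a uniform point of `R` is uniform on `[0,q)` (`q · #{a ∈ R : a_i = x} = #R` for all
`i` and all `x ∈ [0,q)`), then `q · #{a ∈ R : a + s ∉ [0,q)^m} ≤ #R · Σ_i |s_i|`. [folklore] -/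
theorem mul_card_filter_add_not_mem_intBox_le (q : ℕ) (R : Finset (Fin m → ℤ)) (hR : R ⊆ intBox m q)
    (hmarg : ∀ i, ∀ x ∈ Finset.Ico (0 : ℤ) q, q * (R.filter fun a => a i = x).card = R.card)
    (s : Fin m → ℤ) :
    q * (R.filter fun a => a + s ∉ intBox m q).card ≤ R.card * ∑ i, (s i).natAbs := by
  have hsub : (R.filter fun a => a + s ∉ intBox m q)
      ⊆ Finset.univ.biUnion fun i => R.filter fun a => a i + s i ∉ Finset.Ico (0 : ℤ) q := by
    intro a ha
    rw [Finset.mem_filter, mem_intBox, not_forall] at ha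
    obtain ⟨haR, i, hi⟩ := ha
    exact Finset.mem_biUnion.2 ⟨i, Finset.mem_univ _, Finset.mem_filter.2 ⟨haR, hi⟩⟩
  have hcoord : ∀ i, q * (R.filter fun a => a i + s i ∉ Finset.Ico (0 : ℤ) q).card
      ≤ R.card * (s i).natAbs := by
    intro i
    have hmaps : (↑(R.filter fun a => a i + s i ∉ Finset.Ico (0 : ℤ) q) : Set (Fin m → ℤ)).MapsTo
        (fun a => a i) ↑((Finset.Ico (0 : ℤ) q).filter fun x => x + s i ∉ Finset.Ico (0 : ℤ) q) := by
      intro a ha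
      rw [Finset.coe_filter, Set.mem_setOf_eq] at ha
      rw [Finset.mem_coe, Finset.mem_filter]
      exact ⟨(mem_intBox.1 (hR ha.1)) i, ha.2⟩
    have hfib : ∀ x ∈ (Finset.Ico (0 : ℤ) q).filter (fun x => x + s i ∉ Finset.Ico (0 : ℤ) q),
        ((R.filter fun a => a i + s i ∉ Finset.Ico (0 : ℤ) q).filter fun a => a i = x)
          = R.filter fun a => a i = x := by
      intro x hx
      rw [Finset.filter_filter]
      refine Finset.filter_congr fun a _ => ⟨fun h => h.2, fun h => ⟨?_, h⟩⟩
      rw [h]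
      exact (Finset.mem_filter.1 hx).2
    calc q * (R.filter fun a => a i + s i ∉ Finset.Ico (0 : ℤ) q).card
        = q * ∑ x ∈ (Finset.Ico (0 : ℤ) q).filter (fun x => x + s i ∉ Finset.Ico (0 : ℤ) q),
            (((R.filter fun a => a i + s i ∉ Finset.Ico (0 : ℤ) q).filter fun a => a i = x)).card := by
          rw [Finset.card_eq_sum_card_fiberwise hmaps]
      _ = ∑ x ∈ (Finset.Ico (0 : ℤ) q).filter (fun x => x + s i ∉ Finset.Ico (0 : ℤ) q),
            q * (R.filter fun a => a i = x).card := by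
          rw [Finset.mul_sum]
          exact Finset.sum_congr rfl fun x hx => by rw [hfib x hx]
      _ = ∑ x ∈ (Finset.Ico (0 : ℤ) q).filter (fun x => x + s i ∉ Finset.Ico (0 : ℤ) q), R.card :=
          Finset.sum_congr rfl fun x hx => hmarg i x (Finset.mem_filter.1 hx).1
      _ = ((Finset.Ico (0 : ℤ) q).filter fun x => x + s i ∉ Finset.Ico (0 : ℤ) q).card * R.card := by
          rw [Finset.sum_const, smul_eq_mul]
      _ ≤ (s i).natAbs * R.card := Nat.mul_le_mul_right _ (card_Ico_filter_add_not_mem_le q (s i))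
      _ = R.card * (s i).natAbs := mul_comm _ _
  calc q * (R.filter fun a => a + s ∉ intBox m q).card
      ≤ q * (Finset.univ.biUnion fun i => R.filter fun a => a i + s i ∉ Finset.Ico (0 : ℤ) q).card :=
        Nat.mul_le_mul_left _ (Finset.card_le_card hsub)
    _ ≤ q * ∑ i, (R.filter fun a => a i + s i ∉ Finset.Ico (0 : ℤ) q).card :=
        Nat.mul_le_mul_left _ Finset.card_biUnion_le
    _ = ∑ i, q * (R.filter fun a => a i + s i ∉ Finset.Ico (0 : ℤ) q).card := Finset.mul_sum _ _ _
    _ ≤ ∑ i, R.card * (s i).natAbs := Finset.sum_le_sum fun i _ => hcoord i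
    _ = R.card * ∑ i, (s i).natAbs := (Finset.mul_sum _ _ _).symm

/-- With the CLOSURE property (a translate of a point of `R` that stays in the box stays in `R` —
e.g. `R` = lattice ∩ box and `s` a lattice vector), leaving `R` means leaving the box. [folklore] -/
theorem card_filter_add_not_mem_le_of_closed (q : ℕ) (R : Finset (Fin m → ℤ)) (s : Fin m → ℤ)
    (hclosed : ∀ a ∈ R, a + s ∈ intBox m q → a + s ∈ R) :
    (R.filter fun a => a + s ∉ R).card ≤ (R.filter fun a => a + s ∉ intBox m q).card :=
  Finset.card_le_card fun a ha => by
    rw [Finset.mem_filter] at ha ⊢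
    exact ⟨ha.1, fun hb => ha.2 (hclosed a ha.1 hb)⟩

/-- **The exit probability of a box set under translation** (census §26.2 (iii)): for `R ⊆ [0,q)^m`
non-empty with the closure property and uniform coordinate marginals,
`Pr_{a uniform on R}[a + s ∉ R] ≤ ‖s‖₁ / q`. [folklore] -/
theorem exitProb_le (q : ℕ) (hq : 0 < q) (R : Finset (Fin m → ℤ)) (hRne : R.Nonempty)
    (hR : R ⊆ intBox m q)
    (hmarg : ∀ i, ∀ x ∈ Finset.Ico (0 : ℤ) q, q * (R.filter fun a => a i = x).card = R.card)
    (s : Fin m → ℤ) (hclosed : ∀ a ∈ R, a + s ∈ intBox m q → a + s ∈ R) :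
    (R.card : ℝ)⁻¹ * ((R.filter fun a => a + s ∉ R).card : ℝ) ≤ (∑ i, ((s i).natAbs : ℝ)) / q := by
  have h := (Nat.mul_le_mul_left q (card_filter_add_not_mem_le_of_closed q R s hclosed)).trans
    (mul_card_filter_add_not_mem_intBox_le q R hR hmarg s)
  have h' : (q : ℝ) * ((R.filter fun a => a + s ∉ R).card : ℝ) ≤ (R.card : ℝ) * ∑ i, ((s i).natAbs : ℝ) := by
    exact_mod_cast h
  have hRpos : (0 : ℝ) < R.card := Nat.cast_pos.2 hRne.card_pos
  have hqpos : (0 : ℝ) < q := Nat.cast_pos.2 hq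
  rw [← div_eq_inv_mul, div_le_div_iff₀ hRpos hqpos]
  linarith

end Box

/-! ### The centred residue system: `Σ_{k ∈ ℤ_Q} |k̃| = (Q² − 1)/4` for odd `Q` -/

/-- For odd `N`, the centred lifts `valMinAbs` of the residues mod `N` have total absolute value
`(N/2)·(N/2 + 1) = (N² − 1)/4`. [folklore] -/
theorem sum_natAbs_valMinAbs (N : ℕ) [NeZero N] (hN : Odd N) :
    ∑ k : ZMod N, k.valMinAbs.natAbs = (N / 2) * (N / 2 + 1) := by
  obtain ⟨h, rfl⟩ := hN
  have hdiv : (2 * h + 1) / 2 = h := by omega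
  rw [hdiv]
  have hF : ∀ k : ZMod (2 * h + 1), k.valMinAbs.natAbs
      = if k.val ≤ h then k.val else 2 * h + 1 - k.val := by
    intro k
    have hk : k.val < 2 * h + 1 := k.val_lt
    rw [ZMod.valMinAbs_def_pos, hdiv]
    split_ifs with hle
    · rfl
    · omega
  have himg : (Finset.univ : Finset (ZMod (2 * h + 1))).image ZMod.val = Finset.range (2 * h + 1) := by
    apply Finset.eq_of_subset_of_card_le
    · intro v hv
      obtain ⟨k, _, rfl⟩ := Finset.mem_image.1 hv
      exact Finset.mem_range.2 k.val_lt
    · rw [Finset.card_range, Finset.card_image_of_injective _ (ZMod.val_injective _), Finset.card_univ,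
        ZMod.card]
  rw [Finset.sum_congr rfl fun k _ => hF k,
    ← Finset.sum_image (f := fun v => if v ≤ h then v else 2 * h + 1 - v)
      (fun k _ k' _ hkk => ZMod.val_injective _ hkk), himg]
  have hsplit := Finset.sum_range_add (fun v => if v ≤ h then v else 2 * h + 1 - v) (h + 1) h
  rw [show (h + 1) + h = 2 * h + 1 by ring] at hsplit
  rw [hsplit]
  have h1 : ∑ v ∈ Finset.range (h + 1), (if v ≤ h then v else 2 * h + 1 - v)
      = ∑ v ∈ Finset.range (h + 1), v :=
    Finset.sum_congr rfl fun v hv => if_pos (Nat.lt_succ_iff.1 (Finset.mem_range.1 hv))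
  have h2 : ∑ j ∈ Finset.range h, (if h + 1 + j ≤ h then h + 1 + j else 2 * h + 1 - (h + 1 + j))
      = ∑ j ∈ Finset.range h, (h - j) :=
    Finset.sum_congr rfl fun j _ => by rw [if_neg (by omega)]; omega
  have h3 : ∑ j ∈ Finset.range h, (h - j) = ∑ j ∈ Finset.range h, (j + 1) := by
    rw [← Finset.sum_range_reflect (fun j => j + 1) h]
    exact Finset.sum_congr rfl fun j hj => by
      have := Finset.mem_range.1 hj
      omega
  have hG : (∑ j ∈ Finset.range h, (j + 1)) * 2 = h * (h + 1) := by
    have := Finset.sum_range_id_mul_two (h + 1)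
    rw [Finset.sum_range_succ', Nat.add_sub_cancel, add_zero] at this
    rw [this, mul_comm]
  rw [h1, h2, h3, Finset.sum_range_succ' (fun v => v), add_zero, ← hG, mul_two]

/-- Real-valued form: `Σ_{k ∈ ℤ_N} |valMinAbs k| = (N² − 1)/4` for odd `N`. [folklore] -/
theorem sum_natAbs_valMinAbs_real (N : ℕ) [NeZero N] (hN : Odd N) :
    ∑ k : ZMod N, ((k.valMinAbs.natAbs : ℕ) : ℝ) = ((N : ℝ) ^ 2 - 1) / 4 := by
  rw [← Nat.cast_sum, sum_natAbs_valMinAbs N hN]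
  obtain ⟨h, rfl⟩ := hN
  rw [show (2 * h + 1) / 2 = h by omega]
  push_cast
  ring

/-! ### C. The Step-9 register: digit observers of a hidden vector uniform on a finite set -/

section Register

variable (n : ℕ) (D p₁ Q : ℕ+) (b : Fin (n + 1) → ℤ)

section Finite

variable {m : ℕ} {Sd : Type*}

/-- What the statistics of a digit observer depend on: the offset mod `N` and the side information
(`phi8bKet_congr_mod`). [cite: ChenQuantumLattice2024, §3.5.9 p. 35] -/
def obsProj (off : (Fin m → ℤ) → Fin (n + 1) → ℤ) (f : (Fin m → ℤ) → Sd) (a : Fin m → ℤ) :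
    (Fin (n + 1) → ZN D p₁ Q) × Sd :=
  (fun i => ((off a i : ℤ) : ZN D p₁ Q), f a)

/-- The line translation by `p₁t_k` steps acting on (offset mod `N`, side information).
[cite: ChenQuantumLattice2024, §3.5.9 p. 35] -/
def obsShift (t : ZQ Q → ℤ) (k : ZQ Q) (x : (Fin (n + 1) → ZN D p₁ Q) × Sd) :
    (Fin (n + 1) → ZN D p₁ Q) × Sd :=
  (residueShift n D p₁ Q b t k x.1, x.2)

/-- The translation on (offset mod `N`, side information) is a bijection. [folklore] -/
theorem obsShift_bijective (t : ZQ Q → ℤ) (k : ZQ Q) :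
    Function.Bijective (obsShift n D p₁ Q b (Sd := Sd) t k) := by
  refine ⟨fun x y hxy => Prod.ext ?_ (congrArg Prod.snd hxy :), fun y => ?_⟩
  · exact (residueShift_bijective n D p₁ Q b t k).1 (congrArg Prod.fst hxy :)
  · obtain ⟨x1, hx1⟩ := (residueShift_bijective n D p₁ Q b t k).2 y.1
    exact ⟨(x1, y.2), Prod.ext hx1 rfl⟩

variable [Fintype Sd] [DecidableEq Sd]

/-- **T21 (a) — digit observers of a hidden vector uniform on a finite set.**  Odd `P`, `b₀ = −1`,
`2D²p₁` a unit mod `Q`, `t` any complete residue system mod `Q`.  The hidden vector `a` is uniform on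
the finite non-empty `R ⊂ ℤ^m`; it carries the offset `off a` of the register `|φ_{b, off a}⟩` and
the side information `f a`; the translations `a ↦ a + s_k` act on the offset as the line translations
by `p₁t_k` steps (mod `N`) and fix `f`, on `R`.  Then every digit observer reads the datum
`(off a)₀ mod Q` with probability at most `(1 + Σ_k Pr_a[a + s_k ∉ R]) / Q`.
[cite: ChenQuantumLattice2024, §3.5.9 pp. 35–37; census §26.2 (ii)] -/
theorem finsetDigitObserver_le (hP : Odd ((p₁ * Q : ℕ+) : ℕ)) (hb : b 0 = -1)
    (hunit : IsUnit ((2 * D * D * p₁ : ℕ) : ZQ Q))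
    (t : ZQ Q → ℤ) (ht : ∀ k, ((t k : ℤ) : ZQ Q) = k)
    (R : Finset (Fin m → ℤ)) (hR : R.Nonempty)
    (off : (Fin m → ℤ) → Fin (n + 1) → ℤ) (s : ZQ Q → Fin m → ℤ)
    (hoff : ∀ k, ∀ a ∈ R, ∀ i, ((off (a + s k) i : ℤ) : ZN D p₁ Q)
      = ((lineShift n D b (off a) (((p₁ : ℕ) : ℤ) * t k) i : ℤ) : ZN D p₁ Q))
    (f : (Fin m → ℤ) → Sd) (hf : ∀ k, ∀ a ∈ R, f (a + s k) = f a)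
    (g : (Fin (n + 1) → ZN D p₁ Q) × Sd → ZQ Q → ℝ)
    (hg : ∀ o a', 0 ≤ g o a') (hg1 : ∀ o, ∑ a', g o a' = 1) :
    (R.card : ℝ)⁻¹ * ∑ a ∈ R, ∑ o, digitKernel n D p₁ Q b off f a o
        * g o (toDatum D p₁ Q ((off a 0 : ℤ) : ZN D p₁ Q))
      ≤ (1 + (R.card : ℝ)⁻¹ * ∑ k, ((R.filter fun a => a + s k ∉ R).card : ℝ)) / ((Q : ℕ) : ℝ) := by
  -- push the success forward to the finite model (offset mod N, side information)
  have hsucc : (R.card : ℝ)⁻¹ * ∑ a ∈ R, ∑ o, digitKernel n D p₁ Q b off f a o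
        * g o (toDatum D p₁ Q ((off a 0 : ℤ) : ZN D p₁ Q))
      = guessSuccess (pushLaw R (obsProj n D p₁ Q off f) (R.card : ℝ)⁻¹)
          (digitKernel n D p₁ Q b (fun x => liftV n D p₁ Q x.1) Prod.snd) g
          (fun x => toDatum D p₁ Q ((liftV n D p₁ Q x.1 0 : ℤ) : ZN D p₁ Q)) := by
    refine mul_sum_success_eq_guessSuccess_pushLaw R (obsProj n D p₁ Q off f) _ _ _
      (fun a _ o => ?_) g _ _ (fun a _ => ?_)
    · have hk : phi8bKet n D p₁ Q b (off a)
          = phi8bKet n D p₁ Q b (liftV n D p₁ Q (obsProj n D p₁ Q off f a).1) :=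
        phi8bKet_congr_mod n D p₁ Q b fun i => by rw [intCast_liftV]; rfl
      simp only [digitKernel, hk]
      rfl
    · rw [intCast_liftV]
      rfl
  -- T17 on the finite model
  have hT17 := digitObserver_le n D p₁ Q b hP hb hunit t ht
    (fun x : (Fin (n + 1) → ZN D p₁ Q) × Sd => liftV n D p₁ Q x.1) (obsShift n D p₁ Q b t)
    (obsShift_bijective n D p₁ Q b t) (fun k x i => intCast_liftV_residueShift n D p₁ Q b t k x.1 i)
    Prod.snd (fun k x => rfl) (pushLaw R (obsProj n D p₁ Q off f) (R.card : ℝ)⁻¹) g hg hg1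
  -- the defects are exit probabilities
  have hdef : ∀ k, lawShiftDefect (pushLaw R (obsProj n D p₁ Q off f) (R.card : ℝ)⁻¹)
      (obsShift n D p₁ Q b t k) ≤ (R.card : ℝ)⁻¹ * ((R.filter fun a => a + s k ∉ R).card : ℝ) := by
    intro k
    refine lawShiftDefect_pushLaw_le R (obsProj n D p₁ Q off f) (inv_nonneg.2 (Nat.cast_nonneg _))
      (· + s k) (fun a _ a' _ h => add_right_cancel h) (obsShift n D p₁ Q b t k)
      (obsShift_bijective n D p₁ Q b t k) (fun a ha => ?_)
    refine Prod.ext (funext fun i => ?_) (hf k a ha)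
    show ((off (a + s k) i : ℤ) : ZN D p₁ Q) = ((off a i : ℤ) : ZN D p₁ Q) + shiftVec n D p₁ Q b t k i
    rw [hoff k a ha i]
    simp only [lineShift, shiftVec, Int.cast_add]
  rw [hsucc]
  refine hT17.trans (div_le_div_of_nonneg_right ?_ (Nat.cast_nonneg _))
  rw [sum_pushLaw_uniform R hR, Finset.mul_sum]
  exact add_le_add le_rfl (Finset.sum_le_sum fun k _ => hdef k)

/-- **T21 (b) — Lemma C in the kernel: the box-wrap bound.**  If moreover `R ⊆ [0,q)^m` has the
closure property under every `s_k` and uniform coordinate marginals, every digit observer reads the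
datum with probability at most `1/Q + (Σ_k ‖s_k‖₁) / (Q·q)`.
[cite: ChenQuantumLattice2024, §3.5.9 pp. 35–37, §3.2 pp. 16–18; census §26.2 (ii)–(iii)] -/
theorem boxDigitObserver_le (hP : Odd ((p₁ * Q : ℕ+) : ℕ)) (hb : b 0 = -1)
    (hunit : IsUnit ((2 * D * D * p₁ : ℕ) : ZQ Q))
    (t : ZQ Q → ℤ) (ht : ∀ k, ((t k : ℤ) : ZQ Q) = k)
    (q : ℕ) (hq : 0 < q) (R : Finset (Fin m → ℤ)) (hR : R.Nonempty) (hRbox : R ⊆ intBox m q)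
    (hmarg : ∀ i, ∀ x ∈ Finset.Ico (0 : ℤ) q, q * (R.filter fun a => a i = x).card = R.card)
    (off : (Fin m → ℤ) → Fin (n + 1) → ℤ) (s : ZQ Q → Fin m → ℤ)
    (hclosed : ∀ k, ∀ a ∈ R, a + s k ∈ intBox m q → a + s k ∈ R)
    (hoff : ∀ k, ∀ a ∈ R, ∀ i, ((off (a + s k) i : ℤ) : ZN D p₁ Q)
      = ((lineShift n D b (off a) (((p₁ : ℕ) : ℤ) * t k) i : ℤ) : ZN D p₁ Q))
    (f : (Fin m → ℤ) → Sd) (hf : ∀ k, ∀ a ∈ R, f (a + s k) = f a)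
    (g : (Fin (n + 1) → ZN D p₁ Q) × Sd → ZQ Q → ℝ)
    (hg : ∀ o a', 0 ≤ g o a') (hg1 : ∀ o, ∑ a', g o a' = 1) :
    (R.card : ℝ)⁻¹ * ∑ a ∈ R, ∑ o, digitKernel n D p₁ Q b off f a o
        * g o (toDatum D p₁ Q ((off a 0 : ℤ) : ZN D p₁ Q))
      ≤ 1 / ((Q : ℕ) : ℝ) + (∑ k, ∑ i, ((s k i).natAbs : ℝ)) / (((Q : ℕ) : ℝ) * q) := by
  have h := finsetDigitObserver_le n D p₁ Q b hP hb hunit t ht R hR off s hoff f hf g hg hg1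
  have hex : (R.card : ℝ)⁻¹ * ∑ k, ((R.filter fun a => a + s k ∉ R).card : ℝ)
      ≤ (∑ k, ∑ i, ((s k i).natAbs : ℝ)) / q := by
    rw [Finset.mul_sum, Finset.sum_div]
    exact Finset.sum_le_sum fun k _ => exitProb_le q hq R hR hRbox hmarg (s k) (hclosed k)
  have hQ : (0 : ℝ) < ((Q : ℕ) : ℝ) := by positivity
  have hqpos : (0 : ℝ) < q := Nat.cast_pos.2 hq
  calc _ ≤ (1 + (R.card : ℝ)⁻¹ * ∑ k, ((R.filter fun a => a + s k ∉ R).card : ℝ)) / ((Q : ℕ) : ℝ) := h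
    _ ≤ (1 + (∑ k, ∑ i, ((s k i).natAbs : ℝ)) / q) / ((Q : ℕ) : ℝ) :=
        div_le_div_of_nonneg_right (add_le_add le_rfl hex) hQ.le
    _ = 1 / ((Q : ℕ) : ℝ) + (∑ k, ∑ i, ((s k i).natAbs : ℝ)) / (((Q : ℕ) : ℝ) * q) := by
        rw [add_div, div_div, mul_comm (q : ℝ)]

end Finite

/-! ### Chen's offsets `v′ = D·(w₀ − ν)` and translations `ν ↦ ν − 2Dp₁t_k·b` -/

section Chen

/-- Chen's offset as a function of the hidden lattice vector `ν`: `v′ = D·(w₀ − ν)` (`w₀ = k′b`; the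
register holds `D·(k′b − ν) + 2D²j·b mod N`). [cite: ChenQuantumLattice2024, §3.5.9 p. 35] -/
def chenOff (w₀ ν : Fin (n + 1) → ℤ) : Fin (n + 1) → ℤ := fun i => ((D : ℕ) : ℤ) * (w₀ i - ν i)

/-- The translation of the hidden vector by `−2Dp₁t_k·b` (a lattice vector: `b ∈ L_q^⊥`), which moves
the offset `p₁t_k` steps along the line. [cite: ChenQuantumLattice2024, §3.5.9 p. 35, eq. (12) p. 17] -/
def hiddenShift (t : ZQ Q → ℤ) (k : ZQ Q) : Fin (n + 1) → ℤ :=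
  fun i => -(((2 * (D : ℕ) * (p₁ : ℕ) : ℕ) : ℤ) * t k * b i)

/-- The hidden-vector translation moves Chen's offset EXACTLY (over `ℤ`) by the line translation with
`p₁t_k` steps. [cite: ChenQuantumLattice2024, §3.5.9 p. 35] -/
theorem chenOff_add_hiddenShift (w₀ : Fin (n + 1) → ℤ) (t : ZQ Q → ℤ) (k : ZQ Q)
    (ν : Fin (n + 1) → ℤ) :
    chenOff n D w₀ (ν + hiddenShift n D p₁ Q b t k)
      = lineShift n D b (chenOff n D w₀ ν) (((p₁ : ℕ) : ℤ) * t k) := by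
  funext i
  simp only [chenOff, hiddenShift, lineShift, Pi.add_apply]
  push_cast
  ring

/-- The `ℓ¹` size of the translations: `Σ_k ‖2Dp₁t_k·b‖₁ = 2Dp₁ · ‖b‖₁ · Σ_k |t_k|`. [folklore] -/
theorem sum_natAbs_hiddenShift (t : ZQ Q → ℤ) :
    ∑ k, ∑ i, ((hiddenShift n D p₁ Q b t k i).natAbs : ℝ)
      = 2 * ((D : ℕ) : ℝ) * ((p₁ : ℕ) : ℝ) * (∑ i, ((b i).natAbs : ℝ)) * ∑ k, ((t k).natAbs : ℝ) := by
  simp only [hiddenShift, Int.natAbs_neg, Int.natAbs_mul, Int.natAbs_natCast]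
  push_cast
  simp_rw [← Finset.mul_sum]
  rw [← Finset.sum_mul, ← Finset.mul_sum]
  ring

/-- **T21 (c) — the box-wrap bound for Chen's offsets.**  Odd `P = p₁Q`, `b₀ = −1`, `2D²p₁` a unit
mod `Q`, `t` any complete residue system mod `Q`; the hidden vector `ν` uniform on a non-empty
`R ⊆ [0,q)^{n+1}` closed under the lattice translations `ν ↦ ν − 2Dp₁t_k·b` inside the box and with
uniform coordinate marginals; offset `v′ = D·(w₀ − ν)`; side information `f` invariant under the
translations on `R`.  Then every digit observer reads the datum `v′₀ mod Q` with probability at most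
`1/Q + 2Dp₁‖b‖₁(Σ_k |t_k|)/(Q·q)`. [cite: ChenQuantumLattice2024, §3.5.9 pp. 35–37, §3.2 pp. 16–18,
eq. (12) p. 17; census §26.2] -/
theorem chenBoxDigitObserver_le (hP : Odd ((p₁ * Q : ℕ+) : ℕ)) (hb : b 0 = -1)
    (hunit : IsUnit ((2 * D * D * p₁ : ℕ) : ZQ Q))
    (t : ZQ Q → ℤ) (ht : ∀ k, ((t k : ℤ) : ZQ Q) = k)
    {Sd : Type*} [Fintype Sd] [DecidableEq Sd]
    (q : ℕ) (hq : 0 < q) (R : Finset (Fin (n + 1) → ℤ)) (hR : R.Nonempty)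
    (hRbox : R ⊆ intBox (n + 1) q)
    (hmarg : ∀ i, ∀ x ∈ Finset.Ico (0 : ℤ) q, q * (R.filter fun a => a i = x).card = R.card)
    (hclosed : ∀ k, ∀ ν ∈ R, ν + hiddenShift n D p₁ Q b t k ∈ intBox (n + 1) q →
      ν + hiddenShift n D p₁ Q b t k ∈ R)
    (w₀ : Fin (n + 1) → ℤ) (f : (Fin (n + 1) → ℤ) → Sd)
    (hf : ∀ k, ∀ ν ∈ R, f (ν + hiddenShift n D p₁ Q b t k) = f ν)
    (g : (Fin (n + 1) → ZN D p₁ Q) × Sd → ZQ Q → ℝ)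
    (hg : ∀ o a', 0 ≤ g o a') (hg1 : ∀ o, ∑ a', g o a' = 1) :
    (R.card : ℝ)⁻¹ * ∑ ν ∈ R, ∑ o, digitKernel n D p₁ Q b (chenOff n D w₀) f ν o
        * g o (toDatum D p₁ Q ((chenOff n D w₀ ν 0 : ℤ) : ZN D p₁ Q))
      ≤ 1 / ((Q : ℕ) : ℝ) + 2 * ((D : ℕ) : ℝ) * ((p₁ : ℕ) : ℝ) * (∑ i, ((b i).natAbs : ℝ))
          * (∑ k, ((t k).natAbs : ℝ)) / (((Q : ℕ) : ℝ) * q) := by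
  have h := boxDigitObserver_le n D p₁ Q b hP hb hunit t ht q hq R hR hRbox hmarg (chenOff n D w₀)
    (hiddenShift n D p₁ Q b t) hclosed
    (fun k ν _ i => by rw [chenOff_add_hiddenShift]) f hf g hg hg1
  rwa [sum_natAbs_hiddenShift] at h

/-- **T21 (d) — the centred residue system: census §26.2's constant.**  With `t_k` the centred lift
(`|t_k| ≤ (Q−1)/2`, `Σ_k |t_k| = (Q²−1)/4` for odd `Q`), the bound of (c) reads
`1/Q + Dp₁(Q² − 1)‖b‖₁ / (2Qq)` — the census's `1/C + W`, `W ≤ Dp₁(C²−1)‖b‖₁/(2Cq)` (this module's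
`Q` is the census's `C`). [cite: ChenQuantumLattice2024, §3.5.9 pp. 35–37; census §26.2 (iii)] -/
theorem chenBoxDigitObserver_le_centred (hP : Odd ((p₁ * Q : ℕ+) : ℕ)) (hb : b 0 = -1)
    (hunit : IsUnit ((2 * D * D * p₁ : ℕ) : ZQ Q))
    {Sd : Type*} [Fintype Sd] [DecidableEq Sd]
    (q : ℕ) (hq : 0 < q) (R : Finset (Fin (n + 1) → ℤ)) (hR : R.Nonempty)
    (hRbox : R ⊆ intBox (n + 1) q)
    (hmarg : ∀ i, ∀ x ∈ Finset.Ico (0 : ℤ) q, q * (R.filter fun a => a i = x).card = R.card)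
    (hclosed : ∀ k, ∀ ν ∈ R, ν + hiddenShift n D p₁ Q b (fun k => k.valMinAbs) k ∈ intBox (n + 1) q →
      ν + hiddenShift n D p₁ Q b (fun k => k.valMinAbs) k ∈ R)
    (w₀ : Fin (n + 1) → ℤ) (f : (Fin (n + 1) → ℤ) → Sd)
    (hf : ∀ k, ∀ ν ∈ R, f (ν + hiddenShift n D p₁ Q b (fun k => k.valMinAbs) k) = f ν)
    (g : (Fin (n + 1) → ZN D p₁ Q) × Sd → ZQ Q → ℝ)
    (hg : ∀ o a', 0 ≤ g o a') (hg1 : ∀ o, ∑ a', g o a' = 1) :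
    (R.card : ℝ)⁻¹ * ∑ ν ∈ R, ∑ o, digitKernel n D p₁ Q b (chenOff n D w₀) f ν o
        * g o (toDatum D p₁ Q ((chenOff n D w₀ ν 0 : ℤ) : ZN D p₁ Q))
      ≤ 1 / ((Q : ℕ) : ℝ) + ((D : ℕ) : ℝ) * ((p₁ : ℕ) : ℝ) * (((Q : ℕ) : ℝ) ^ 2 - 1)
          * (∑ i, ((b i).natAbs : ℝ)) / (2 * ((Q : ℕ) : ℝ) * q) := by
  have hQodd : Odd ((Q : ℕ+) : ℕ) := (Nat.odd_mul.1 (by simpa [PNat.mul_coe] using hP)).2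
  have h := chenBoxDigitObserver_le n D p₁ Q b hP hb hunit (fun k => k.valMinAbs)
    (fun k => ZMod.coe_valMinAbs k) q hq R hR hRbox hmarg hclosed w₀ f hf g hg hg1
  beta_reduce at h
  rw [sum_natAbs_valMinAbs_real _ hQodd] at h
  refine h.trans (le_of_eq ?_)
  have hQ : (((Q : ℕ+) : ℕ) : ℝ) ≠ 0 := by positivity
  have hq' : (q : ℝ) ≠ 0 := (Nat.cast_pos.2 hq).ne'
  field_simp
  ring

end Chen

/-! ### D. Parity-check boxes: `L_q^⊥(A) ∩ [0,q)^m` has the closure property -/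

section CheckBox

variable {m : ℕ} {ι : Type*} [Fintype ι] (q : ℕ) (κ : ι → ((Fin m → ℤ) →+ ZMod q))

/-- A `q`-ary PARITY-CHECK BOX: the points of `[0,q)^m` annihilated by the additive checks `κ_j`
into `ℤ_q` — Chen's `L_q^⊥(A) ∩ [0,q)^n` with `κ_j` = row `j` of the instance matrix, i.e. the set of
canonical representatives of `L_q^⊥(A)/qℤ^n`. [cite: ChenQuantumLattice2024, §3.2 pp. 16–18] -/
noncomputable def checkBox : Finset (Fin m → ℤ) := (intBox m q).filter fun a => ∀ j, κ j a = 0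

/-- A parity-check box lies in the box. [folklore] -/
theorem checkBox_subset_intBox : checkBox q κ ⊆ intBox m q := Finset.filter_subset _ _

/-- The zero vector is in every parity-check box (`q ≥ 1`), so the box is non-empty. [folklore] -/
theorem checkBox_nonempty (hq : 0 < q) : (checkBox q κ).Nonempty := by
  refine ⟨0, Finset.mem_filter.2 ⟨mem_intBox.2 fun i => ?_, fun j => map_zero (κ j)⟩⟩
  simp only [Pi.zero_apply, Finset.mem_Ico, le_refl, true_and]
  exact_mod_cast hq

/-- **Closure.**  Translating a point of the parity-check box by a vector ANNIHILATED BY THE CHECKS (a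
vector of `L_q^⊥(A)`, e.g. any integer multiple of Chen's `b`) and staying in the box stays in the
parity-check box. [cite: ChenQuantumLattice2024, §3.2 pp. 16–18, eq. (12) p. 17] -/
theorem checkBox_closed (s : Fin m → ℤ) (hs : ∀ j, κ j s = 0) :
    ∀ a ∈ checkBox q κ, a + s ∈ intBox m q → a + s ∈ checkBox q κ := by
  intro a ha hbox
  rw [checkBox, Finset.mem_filter] at ha ⊢
  exact ⟨hbox, fun j => by rw [map_add, ha.2 j, hs j, add_zero]⟩

omit [Fintype ι] in
/-- Integer multiples of an annihilated vector are annihilated. [folklore] -/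
theorem checks_zsmul (s : Fin m → ℤ) (hs : ∀ j, κ j s = 0) (c : ℤ) : ∀ j, κ j (c • s) = 0 :=
  fun j => by rw [map_zsmul, hs j, smul_zero]

end CheckBox

section ChenCheckBox

/-- Chen's hidden-vector translation is the integer multiple `(−2Dp₁t_k) • b` of the secret.
[cite: ChenQuantumLattice2024, §3.5.9 p. 35] -/
theorem hiddenShift_eq_zsmul (t : ZQ Q → ℤ) (k : ZQ Q) :
    hiddenShift n D p₁ Q b t k = (-(((2 * (D : ℕ) * (p₁ : ℕ) : ℕ) : ℤ) * t k)) • b := by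
  funext i
  simp only [hiddenShift, Pi.smul_apply, smul_eq_mul]
  ring

/-- **T21 (e) — the box-wrap bound on Chen's parity-check box.**  Odd `P = p₁Q`, `b₀ = −1`, `2D²p₁` a
unit mod `Q`; the hidden vector `ν` uniform on the parity-check box `R = L_q^⊥(A) ∩ [0,q)^{n+1}`
(checks `κ`), the secret `b` annihilated by the checks (`b ∈ L_q^⊥(A)`), the coordinate marginals of
`R` uniform (the one hypothesis left to the census: every public row non-zero mod `q`), offset
`v′ = D·(w₀ − ν)`, side information invariant under `ν ↦ ν − 2Dp₁t_k·b` on `R` (centred `t_k`).  Then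
every digit observer reads the datum with probability at most `1/Q + Dp₁(Q² − 1)‖b‖₁/(2Qq)`.
[cite: ChenQuantumLattice2024, §3.5.9 pp. 35–37, §3.2 pp. 16–18, eq. (12) p. 17; census §26.2] -/
theorem chenCheckBoxDigitObserver_le_centred (hP : Odd ((p₁ * Q : ℕ+) : ℕ)) (hb : b 0 = -1)
    (hunit : IsUnit ((2 * D * D * p₁ : ℕ) : ZQ Q))
    {Sd ι : Type*} [Fintype Sd] [DecidableEq Sd] [Fintype ι]
    (q : ℕ) (hq : 0 < q) (κ : ι → ((Fin (n + 1) → ℤ) →+ ZMod q)) (hbκ : ∀ j, κ j b = 0)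
    (hmarg : ∀ i, ∀ x ∈ Finset.Ico (0 : ℤ) q,
      q * ((checkBox q κ).filter fun a => a i = x).card = (checkBox q κ).card)
    (w₀ : Fin (n + 1) → ℤ) (f : (Fin (n + 1) → ℤ) → Sd)
    (hf : ∀ k, ∀ ν ∈ checkBox q κ, f (ν + hiddenShift n D p₁ Q b (fun k => k.valMinAbs) k) = f ν)
    (g : (Fin (n + 1) → ZN D p₁ Q) × Sd → ZQ Q → ℝ)
    (hg : ∀ o a', 0 ≤ g o a') (hg1 : ∀ o, ∑ a', g o a' = 1) :
    ((checkBox q κ).card : ℝ)⁻¹ * ∑ ν ∈ checkBox q κ, ∑ o, digitKernel n D p₁ Q b (chenOff n D w₀) f ν o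
        * g o (toDatum D p₁ Q ((chenOff n D w₀ ν 0 : ℤ) : ZN D p₁ Q))
      ≤ 1 / ((Q : ℕ) : ℝ) + ((D : ℕ) : ℝ) * ((p₁ : ℕ) : ℝ) * (((Q : ℕ) : ℝ) ^ 2 - 1)
          * (∑ i, ((b i).natAbs : ℝ)) / (2 * ((Q : ℕ) : ℝ) * q) :=
  chenBoxDigitObserver_le_centred n D p₁ Q b hP hb hunit q hq (checkBox q κ) (checkBox_nonempty q κ hq)
    (checkBox_subset_intBox q κ) hmarg
    (fun k => by
      rw [hiddenShift_eq_zsmul]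
      exact checkBox_closed q κ _ (checks_zsmul q κ b hbκ _))
    w₀ f hf g hg hg1

end ChenCheckBox

end Register

end Literature.Computability.Cryptography.Chen2024
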